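import Literature.MathematicalPhysics.QuantumFieldTheory.Balaban1983to89.B8Lemma1NonAbelianRecLoops
import Literature.MathematicalPhysics.QuantumFieldTheory.Balaban1983to89.B8Thm2LogB

/-!
# `Balaban1983to89.B8Thm2LogBRec` — [Balaban1985RegularSpaces] Sect. B (1.31)∕(1.37): the configuration `B` of Theorem 2 on the CROSSING bonds, read for the
# RECORD's centred blocks ([Balaban1987RG1] (0.3)): the exponent sum `Σ_{x∈B(b₋)} L^{−d}(1∕i) log (R̄_{0,b₋}V′)(Γ_{b₋,x})` over the centred block with
# the SIGNED covariant product along the trees from the block centre, and the bound (1.37) `|B| < 2dLα₁`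

statement-level skeleton of published theorems with citation tags; proofs where landed; nothing here is a claim about the Yang–Mills mass gap

CITATION HEADER.  [6] = T. Bałaban, *Spaces of regular gauge field configurations on a lattice and gauge fixing conditions*, Commun. Math. Phys. **99**
(1985) 75–102 [Balaban1985RegularSpaces], p. 82 (1.31) (second line: *«(Ū₁ʲ)_b = exp[−i Σ_{x∈B(b₋)} L^{−d} (1∕i) log(R̄^{j−1}_{0,b₋}Ũ′^{j−1})(Γ_{b₋,x})] Ũ′ʲ_b = exp iB_b
for b₋ ∈ Λ_{j−1}, b₊ ∈ Λ_j»*), (1.35), (1.37) *«|B| < 2dLα₁ by the assumption (1.35)»*, (1.19) p. 79 (the covariant product); [I] = [Balaban1987RG1] (0.3) p. 252 (centred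
blocks); [3] = [Balaban1985Averaging] (26) p. 22.
Cell `pub-ymgap`, seat `pub-ymgap-dag-n05-d` g23 — «N05-REC» road, item R2 ([6] Sect. A∕B octet; LEAD PEN dag-n05-e; TOKEN RULE (T2) `boxVec ↦ offZ`, (T5)).  Twin of the
CONTOUR-reading declarations of `B8Thm2LogB` (class C in the lead's kernel census: `crossSum ∕ crossMid ∕ Bcross ∕ BcrossMirror`, `norm_covProd_treeWord_sub_one_le`,
`norm_crossSum_le`, `norm_crossMid_sub_one_le`, `norm_Bcross_le_div`, `norm_mirrorMid_sub_one_le`, `ineq137_crossing(_mirrored)`, `ineq137_of_ineq135`); the interior-bond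
half (`Bint`, `norm_Bint_le_div`, `ineq137_interior`, `arith137`, `BondSmall`, `norm_pert_sub_one_le`, …) is structure-free and REUSED by name.
`--kind definition --supports stmt-QuantumFields-20541` (K0⁷; count-neutral).

POINT 2 (cell bus 2026-08-29): from the block CENTRE the trees `Γ_{b₋,x}` have backward bonds; print's product (1.19) `∏_{b⊂Γ} R(V₀(Γ_{x,b₋}))V′_b` is typed here for
SIGNED words as `covProdS` — the recursion of the engine's forward-only `covProd` plus the reversed-bond step `R(V₀(b))⁻¹(V′_b⁻¹ · …)` forced by (1.17)∕`U(x′,x) =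
U(x,x′)⁻¹` — with the defining property `(V′V₀)(Γ) = (R(V₀)V′)(Γ)·V₀(Γ)` for EVERY word (`hol_mulCfg_eq_covProdS_mul`) and `covProdS = covProd` on forward words.

WHAT IS DEFINED ∕ PROVED (sorry-free).  §1 `covProdS`, `hol_mulCfg_eq_covProdS_mul`, `covProdS_eq_one_iff`, `covProdS_eq_covProd`, `norm_covProdS_sub_one_le` (`≤ |Γ|·t` along any
word whose positions stay in a box where `|V′ − 1| ≤ t`), `norm_covProdS_treeWord_sub_one_le` (`≤ d·s·t` on the centred block, `L = 2s+1`).  §2 `crossSumZ`, `crossMidZ`, `BcrossZ`,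
`BcrossMirrorZ`, `exp_I_smul_BcrossZ`, `neg_I_smul_crossSumZ`.  §3 (1.37): `norm_crossSumZ_le` (`τ∕(1−τ)`, `τ = d·s·t`), `norm_crossMidZ_sub_one_le`, `norm_BcrossZ_le_div`,
★ `ineq137_crossing`, `norm_mirrorMidZ_sub_one_le`, ★ `ineq137_crossing_mirrored`, ★ `ineq137_of_ineq135` — `|B_b| < 2dLα₁` under `dLα₁ ≤ 1∕8` (the count is `d·s + 1 ≤ dL`
bonds instead of the engine's `d(L−1) + 1`).
HONEST SCOPE.  As the engine's; odd `L`; nothing of [6] beyond (1.37)'s elementary bound is asserted; `HThm4Rec` UNDISCHARGED; N05 ∕ N07 NOT discharged; counts unmoved; one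
finite 𝕋⁴ programme at fixed ε — nothing continuum ∕ ℝ⁴ ∕ OS ∕ mass gap ∕ Clay.  No `instance`, no `notation`, no `sorry`.
-/

noncomputable section

open scoped BigOperators
open NormedSpace Finset

namespace Literature.MathematicalPhysics.QuantumFieldTheory.Balaban1983to89.B8Thm2LogBRec

open B7Prop1Explicit MatrixLog BlockAveragingZd B8Lemma1NonAbelianRecLoops
open B8Lemma1NonAbelian (lowPart e_apply_self e_apply_of_ne e_nonneg zsmul_e_apply mulCfg pert pert_mulCfg covProd
  norm_units_mul_sub_one_le)
open B8Ineq129 (vec_apply disp_prefix_treeWord_mem le_of_add_e_le)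
open B8Thm2LogB (BondSmall Bint norm_Iinv_smul norm_negI_smul arith137 ineq137_interior norm_mul_inv_sub_one_le norm_pert_sub_one_le pert_mem)
open Complex (I I_ne_zero)

-- `Site` alone would resolve to the torus sites of `Setup.lean`; re-export the `ℤᵈ` sites of `B7Prop1Explicit`.
export B7Prop1Explicit (Site)

variable {d : ℕ}

/-! ## §1 The covariant product (1.19) along SIGNED words -/

section CovProdS

variable {G : Type*} [Group G]

/-- **(1.19) along a SIGNED word** (POINT 2): `(R(V₀)V′)(Γ) := ∏_{b ⊂ Γ} R(V₀(Γ_{x,b₋}))V′_b`, forward letters as the engine's `covProd`, a backward letter `−e_μ` at `x`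
(the bond `b = ⟨x − e_μ, x⟩` traversed backwards) contributing `R(V₀_b)⁻¹(V′_b⁻¹ · …)` — the law `Ũ′(x′,x) = R(V₀(x′,x))Ũ′(x,x′)⁻¹` forced by (1.17) and
`U(x′,x) = U(x,x′)⁻¹`. [cite: Balaban1985RegularSpaces, (1.17)–(1.19) p.79] -/
def covProdS (V₀ V' : Site d → Fin d → G) : Site d → List (Letter d) → G
  | _, [] => 1
  | x, (μ, true) :: w => V' x μ * (V₀ x μ * covProdS V₀ V' (x + e μ) w * (V₀ x μ)⁻¹)
  | x, (μ, false) :: w => (V₀ (x - e μ) μ)⁻¹ * ((V' (x - e μ) μ)⁻¹ * covProdS V₀ V' (x - e μ) w) * V₀ (x - e μ) μ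

/-- **(1.19) ⟺ equality of parallel transporters, EVERY word**: `(V′V₀)(Γ) = (R(V₀)V′)(Γ) · V₀(Γ)`. [cite: Balaban1985RegularSpaces, (1.19)–(1.21) p.79] -/
theorem hol_mulCfg_eq_covProdS_mul (V₀ V' : Site d → Fin d → G) :
    ∀ (x : Site d) (w : List (Letter d)), hol (mulCfg V' V₀) x w = covProdS V₀ V' x w * hol V₀ x w
  | x, [] => by simp [covProdS]
  | x, (μ, true) :: w => by
    rw [hol_cons, hol_cons, covProdS, stepHol_true, stepHol_true, Letter.vec_true, hol_mulCfg_eq_covProdS_mul V₀ V' (x + e μ) w]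
    simp only [mulCfg]
    group
  | x, (μ, false) :: w => by
    rw [hol_cons, hol_cons, covProdS, stepHol_false, stepHol_false, Letter.vec_false, ← sub_eq_add_neg,
      hol_mulCfg_eq_covProdS_mul V₀ V' (x - e μ) w]
    simp only [mulCfg, mul_inv_rev]
    group

/-- `covProdS_eq_one_iff`: `(R(V₀)V′)(Γ) = 1 ↔ (V′V₀)(Γ) = V₀(Γ)` for EVERY word — the transporter form of (1.19)∕(1.24). [cite: Balaban1985RegularSpaces, (1.19), (1.24) p.79] -/
theorem covProdS_eq_one_iff (V₀ V' : Site d → Fin d → G) (x : Site d) (w : List (Letter d)) :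
    covProdS V₀ V' x w = 1 ↔ hol (mulCfg V' V₀) x w = hol V₀ x w := by
  rw [hol_mulCfg_eq_covProdS_mul V₀ V' x w, mul_eq_right]

/-- On FORWARD words the signed product is the engine's `covProd`. [cite: Balaban1985RegularSpaces, (1.19) p.79] -/
theorem covProdS_eq_covProd (V₀ V' : Site d → Fin d → G) :
    ∀ (x : Site d) (w : List (Letter d)), (∀ l ∈ w, l = (l.1, true)) → covProdS V₀ V' x w = covProd V₀ V' x w
  | x, [], _ => by simp [covProdS, covProd]
  | x, l :: w, h => by
    have hl : l = (l.1, true) := h l (by simp)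
    obtain ⟨μ, b⟩ := l
    simp only at hl
    cases hl
    rw [covProdS, covProd, covProdS_eq_covProd V₀ V' (x + e μ) w fun l' hl' => h l' (List.mem_cons_of_mem _ hl')]
    simp [Letter.vec]

end CovProdS

section CovProdNorm

variable {𝔸 : Type*} [NormedRing 𝔸] [NormOneClass 𝔸]

/-- **The signed product (1.19) of a field close to `1`**: along a word `Γ` of `n` bonds from `x` all of whose positions stay in a box `[lo, hi]` on whose
forward bonds `|V′_c − 1| ≤ t`, with `V₀`, `V′` `U1`-valued, `|(R̄(V₀)V′)(Γ) − 1| ≤ n·t` (conjugations by `U1` are `1`-Lipschitz about `1`; a reversed bond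
contributes `|V′_b⁻¹ − 1| ≤ |V′_b − 1|`). [cite: Balaban1985RegularSpaces, (1.19) p.79, (1.37) p.82] -/
theorem norm_covProdS_sub_one_le (V₀ V' : Site d → Fin d → 𝔸ˣ) (hV₀ : ∀ x κ, V₀ x κ ∈ U1 𝔸)
    (hV' : ∀ x κ, V' x κ ∈ U1 𝔸) {lo hi : Site d} {t : ℝ} (ht : 0 ≤ t) (hs : BondSmall V' lo hi t) :
    ∀ (x : Site d) (w : List (Letter d)),
      (∀ P S : List (Letter d), w = P ++ S → lo ≤ x + disp P ∧ x + disp P ≤ hi) →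
      ‖((covProdS V₀ V' x w : 𝔸ˣ) : 𝔸) - 1‖ ≤ w.length * t
  | x, [], _ => by simp [covProdS]
  | x, (μ, b) :: w, hpos => by
    have hx := hpos [] ((μ, b) :: w) rfl
    rw [disp_nil, add_zero] at hx
    have hxl := hpos [(μ, b)] w rfl
    simp only [disp_cons, disp_nil, add_zero] at hxl
    have htail : ∀ P S : List (Letter d), w = P ++ S →
        lo ≤ x + Letter.vec ((μ, b) : Letter d) + disp P ∧ x + Letter.vec ((μ, b) : Letter d) + disp P ≤ hi := by
      intro P S hPS
      have := hpos ((μ, b) :: P) S (by rw [hPS]; rfl)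
      rwa [disp_cons, ← add_assoc] at this
    cases b
    · -- backward bond `⟨x − e_μ, x⟩`
      have hxm : x - e μ = x + Letter.vec ((μ, false) : Letter d) := by simp [sub_eq_add_neg]
      have ih := norm_covProdS_sub_one_le V₀ V' hV₀ hV' ht hs (x - e μ) w (by rw [hxm]; exact htail)
      have hb : ‖(V' (x - e μ) μ : 𝔸) - 1‖ ≤ t :=
        hs (x - e μ) μ (by rw [hxm]; exact hxl.1) (by rw [sub_add_cancel]; exact hx.2)
      rw [covProdS, List.length_cons, Nat.cast_succ, Units.val_mul, Units.val_mul]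
      refine (norm_units_inv_conj_sub_one_le (hV₀ _ _) _).trans ?_
      calc _ ≤ ‖(((V' (x - e μ) μ)⁻¹ : 𝔸ˣ) : 𝔸) - 1‖ + ‖((covProdS V₀ V' (x - e μ) w : 𝔸ˣ) : 𝔸) - 1‖ :=
            norm_units_mul_sub_one_le ((U1 𝔸).inv_mem (hV' _ _))
        _ ≤ t + w.length * t := add_le_add ((norm_inv_sub_one_le (hV' _ _)).trans hb) ih
        _ = (w.length + 1) * t := by ring
    · -- forward bond `⟨x, x + e_μ⟩`
      have hxp : x + e μ = x + Letter.vec ((μ, true) : Letter d) := by simp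
      have ih := norm_covProdS_sub_one_le V₀ V' hV₀ hV' ht hs (x + e μ) w (by rw [hxp]; exact htail)
      have hb : ‖(V' x μ : 𝔸) - 1‖ ≤ t := hs x μ hx.1 (by rw [hxp]; exact hxl.2)
      rw [covProdS, List.length_cons, Nat.cast_succ]
      calc _ ≤ ‖(V' x μ : 𝔸) - 1‖ + ‖((V₀ x μ * covProdS V₀ V' (x + e μ) w * (V₀ x μ)⁻¹ : 𝔸ˣ) : 𝔸) - 1‖ :=
            norm_units_mul_sub_one_le (hV' x μ)
        _ ≤ t + w.length * t := by
            refine add_le_add hb ?_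
            rw [Units.val_mul, Units.val_mul]
            exact (norm_units_conj_sub_one_le (hV₀ x μ) _).trans ih
        _ = (w.length + 1) * t := by ring

/-- **The tree contour `Γ_{b₋,x}` from the block CENTRE**, `x = q + n`, `|n_i| ≤ s` (`L = 2s+1`): `|(R̄(V₀)V′)(Γ_{q,x}) − 1| ≤ d·s·t` when `|V′ − 1| ≤ t` on the bonds of the
centred block `[q − s𝟙, q + s𝟙]` (the broken line stays in the box spanned by its end-points, `B8Ineq129.disp_prefix_treeWord_mem`; `|Γ| = |n|₁ ≤ d·s`).
[cite: Balaban1985RegularSpaces, (1.31) p.82; Balaban1987RG1, (0.3) p.252] -/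
theorem norm_covProdS_treeWord_sub_one_le {L s : ℕ} (hL : L = 2 * s + 1) (V₀ V' : Site d → Fin d → 𝔸ˣ)
    (hV₀ : ∀ x κ, V₀ x κ ∈ U1 𝔸) (hV' : ∀ x κ, V' x κ ∈ U1 𝔸) {t : ℝ} (ht : 0 ≤ t) (q : Site d)
    (hs : BondSmall V' (q - halfVec L) (q + halfVec L) t) (r : Fin d → Fin L) :
    ‖((covProdS V₀ V' q (treeWord (offZ L r)) : 𝔸ˣ) : 𝔸) - 1‖ ≤ (d : ℝ) * s * t := by
  have hsv : (L - 1) / 2 = s := by omega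
  have hnb : ∀ j, -(s : ℤ) ≤ offZ L r j ∧ offZ L r j ≤ s := fun j => by have := natAbs_offZ_le hL r j; omega
  have hpos : ∀ P S : List (Letter d), treeWord (offZ L r) = P ++ S →
      q - halfVec L ≤ q + disp P ∧ q + disp P ≤ q + halfVec L := by
    intro P S hPS
    constructor <;> intro j <;> have hk := disp_prefix_treeWord_mem (offZ L r) hPS j <;> have := hnb j <;>
      simp only [Pi.sub_apply, Pi.add_apply, halfVec, hsv] <;> omega
  have h := norm_covProdS_sub_one_le V₀ V' hV₀ hV' ht hs q (treeWord (offZ L r)) hpos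
  rw [length_treeWord] at h
  refine h.trans (mul_le_mul_of_nonneg_right ?_ ht)
  exact_mod_cast l1_offZ_le hL r

end CovProdNorm

/-! ## §2 The configuration `B` of (1.31), second line, CENTRED block -/

section SectB

variable {𝔸 : Type*} [NormedRing 𝔸] [NormOneClass 𝔸] [NormedAlgebra ℂ 𝔸] [CompleteSpace 𝔸]
variable (L : ℕ)

/-- **(1.31), second line, the exponent sum, RECORD blocks**: `Σ_{x∈B(b₋)} L^{−d} (1∕i) log(R̄^{j−1}_{0,b₋}V′)(Γ_{b₋,x})` over the CENTRED block `B(b₋) = {q + offZ L r}` with the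
signed product (1.19) along the trees from the centre `q` (twin of `B8Thm2LogB.crossSum`). [cite: Balaban1985RegularSpaces, (1.31) p.82; Balaban1987RG1, (0.3) p.252] -/
def crossSumZ (V₀ V' : Site d → Fin d → 𝔸ˣ) (q : Site d) : 𝔸 :=
  ∑ r : Fin d → Fin L, (((L : ℝ) ^ d)⁻¹) • (I⁻¹ • mlog ((covProdS V₀ V' q (treeWord (offZ L r)) : 𝔸ˣ) : 𝔸))

/-- **(1.31), second line, middle member**, RECORD blocks: `exp[−i Σ_{x∈B(b₋)} …] V′_b` (twin of `B8Thm2LogB.crossMid`). [cite: Balaban1985RegularSpaces, (1.31) p.82] -/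
def crossMidZ (V₀ V' : Site d → Fin d → 𝔸ˣ) (q : Site d) (w : 𝔸ˣ) : 𝔸 :=
  exp ((-I) • crossSumZ L V₀ V' q) * (w : 𝔸)

/-- **(1.31), second line**, RECORD blocks: `B_b := (1∕i) log(exp[−i Σ …] V′_b)` (twin of `B8Thm2LogB.Bcross`). [cite: Balaban1985RegularSpaces, (1.31) p.82] -/
def BcrossZ (V₀ V' : Site d → Fin d → 𝔸ˣ) (q : Site d) (w : 𝔸ˣ) : 𝔸 :=
  I⁻¹ • mlog (crossMidZ L V₀ V' q w)

/-- The MIRRORED crossing bond, RECORD blocks: `B_b := (1∕i) log(V′_b · R(g) exp[+i Σ_{b₊}])`, `g = Ū₀ʲ_b` (twin of `B8Thm2LogB.BcrossMirror`).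
[cite: Balaban1985RegularSpaces, (1.31) p.82 (bookkeeping)] -/
def BcrossMirrorZ (V₀ V' : Site d → Fin d → 𝔸ˣ) (q : Site d) (g w : 𝔸ˣ) : 𝔸 :=
  I⁻¹ • mlog ((w : 𝔸) * ((g : 𝔸) * exp (I • crossSumZ L V₀ V' q) * ((g⁻¹ : 𝔸ˣ) : 𝔸)))

omit [NormOneClass 𝔸] in
/-- **(1.31), second line, as an identity**: `exp iB_b = exp[−i Σ …] V′_b` (inside the domain of `log`). [cite: Balaban1985RegularSpaces, (1.31) p.82] -/
theorem exp_I_smul_BcrossZ (V₀ V' : Site d → Fin d → 𝔸ˣ) (q : Site d) {w : 𝔸ˣ}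
    (hw : ‖crossMidZ L V₀ V' q w - 1‖ < 1) : exp (I • BcrossZ L V₀ V' q w) = crossMidZ L V₀ V' q w := by
  rw [BcrossZ, smul_smul, mul_inv_cancel₀ I_ne_zero, one_smul, exp_mlog hw]

omit [NormOneClass 𝔸] [CompleteSpace 𝔸] in
/-- `−i · Σ_x L^{−d} (1∕i) log P_x = − Σ_x L^{−d} log P_x`. [cite: Balaban1985RegularSpaces, (1.31) p.82 (bookkeeping)] -/
theorem neg_I_smul_crossSumZ (V₀ V' : Site d → Fin d → 𝔸ˣ) (q : Site d) :
    (-I) • crossSumZ L V₀ V' q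
      = -∑ r : Fin d → Fin L, (((L : ℝ) ^ d)⁻¹) • mlog ((covProdS V₀ V' q (treeWord (offZ L r)) : 𝔸ˣ) : 𝔸) := by
  rw [crossSumZ, Finset.smul_sum, ← Finset.sum_neg_distrib]
  refine Finset.sum_congr rfl fun r _ => ?_
  rw [smul_comm, smul_smul, neg_mul, mul_inv_cancel₀ I_ne_zero, neg_one_smul, smul_neg]

/-! ## §3 The bound (1.37) `|B| < 2dLα₁` on the crossing bonds, RECORD blocks -/

/-- The exponent sum of (1.31), RECORD blocks: `‖Σ …‖ ≤ τ∕(1 − τ)`, `τ = d·s·t`, when `|V′ − 1| ≤ t` on the bonds of the centred block and `τ < 1` (`L = 2s+1`).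
[cite: Balaban1985RegularSpaces, (1.31) p.82, (1.37) p.82; Balaban1985Averaging, (26) p.22] -/
theorem norm_crossSumZ_le {s : ℕ} (hL : L = 2 * s + 1) (V₀ V' : Site d → Fin d → 𝔸ˣ) (hV₀ : ∀ x κ, V₀ x κ ∈ U1 𝔸)
    (hV' : ∀ x κ, V' x κ ∈ U1 𝔸) (q : Site d) {t : ℝ} (ht : 0 ≤ t) (hs : BondSmall V' (q - halfVec L) (q + halfVec L) t)
    (hτ : (d : ℝ) * s * t < 1) :
    ‖crossSumZ L V₀ V' q‖ ≤ (d : ℝ) * s * t / (1 - (d : ℝ) * s * t) := by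
  have hL1 : 1 ≤ L := by omega
  unfold crossSumZ
  refine norm_avg_le L hL1 _ fun r => ?_
  rw [norm_Iinv_smul]
  have hP := norm_covProdS_treeWord_sub_one_le hL V₀ V' hV₀ hV' ht q hs r
  have hP1 : ‖((covProdS V₀ V' q (treeWord (offZ L r)) : 𝔸ˣ) : 𝔸) - 1‖ < 1 := hP.trans_lt hτ
  refine (norm_mlog_le_div hP1).trans ?_
  exact div_le_div₀ ((norm_nonneg _).trans hP) hP (by linarith) (by linarith)

omit [NormOneClass 𝔸] in
/-- The middle member of (1.31): `‖exp[−iΣ]V′_b − 1‖ ≤ (e^σ − 1) + |V′_b − 1|` for `‖Σ‖ ≤ σ`, `‖V′_b‖ ≤ 1`. [cite: Balaban1985RegularSpaces, (1.31) p.82, (1.37) p.82] -/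
theorem norm_crossMidZ_sub_one_le (V₀ V' : Site d → Fin d → 𝔸ˣ) (q : Site d) {σ t : ℝ}
    (hS : ‖crossSumZ L V₀ V' q‖ ≤ σ) {w : 𝔸ˣ} (hw1 : ‖(w : 𝔸)‖ ≤ 1) (hw : ‖(w : 𝔸) - 1‖ ≤ t) :
    ‖crossMidZ L V₀ V' q w - 1‖ ≤ (Real.exp σ - 1) + t := by
  have hE : ‖exp ((-I) • crossSumZ L V₀ V' q) - 1‖ ≤ Real.exp σ - 1 :=
    B7Transfer.norm_exp_sub_one_le_of_le _ (by rwa [norm_negI_smul])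
  have hsplit : crossMidZ L V₀ V' q w - 1
      = (exp ((-I) • crossSumZ L V₀ V' q) - 1) * (w : 𝔸) + ((w : 𝔸) - 1) := by
    unfold crossMidZ; noncomm_ring
  rw [hsplit]
  calc _ ≤ ‖(exp ((-I) • crossSumZ L V₀ V' q) - 1) * (w : 𝔸)‖ + ‖(w : 𝔸) - 1‖ := norm_add_le _ _
    _ ≤ ‖exp ((-I) • crossSumZ L V₀ V' q) - 1‖ * ‖(w : 𝔸)‖ + t := add_le_add (norm_mul_le _ _) hw
    _ ≤ (Real.exp σ - 1) * 1 + t := by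
        have h0 : 0 ≤ ‖exp ((-I) • crossSumZ L V₀ V' q) - 1‖ := norm_nonneg _
        nlinarith
    _ = (Real.exp σ - 1) + t := by rw [mul_one]

omit [NormOneClass 𝔸] in
/-- Crossing bonds: `|B_b| ≤ u∕(1 − u)` once `‖exp[−iΣ]V′_b − 1‖ ≤ u < 1` ([3] (26)). [cite: Balaban1985RegularSpaces, (1.37) p.82] -/
theorem norm_BcrossZ_le_div (V₀ V' : Site d → Fin d → 𝔸ˣ) (q : Site d) {w : 𝔸ˣ} {u : ℝ}
    (hmid : ‖crossMidZ L V₀ V' q w - 1‖ ≤ u) (hu : u < 1) : ‖BcrossZ L V₀ V' q w‖ ≤ u / (1 - u) := by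
  rw [BcrossZ, norm_Iinv_smul]
  have h1 : ‖crossMidZ L V₀ V' q w - 1‖ < 1 := hmid.trans_lt hu
  refine (norm_mlog_le_div h1).trans ?_
  exact div_le_div₀ ((norm_nonneg _).trans hmid) hmid (by linarith) (by linarith)

/-- **(1.37) on crossing bonds, RECORD blocks** «|B| < 2dLα₁ by the assumption (1.35)»: `V₀`, `V′` `U1`-valued, `|V′ − 1| ≤ α₁` on the bonds of the centred block `B(b₋)`, `|V′_b − 1|
≤ α₁` at the crossing bond, `0 < α₁`, `dLα₁ ≤ 1∕8` ⟹ `|B_b| < 2dLα₁` (the count: `d·s` tree bonds + the bond `b`, `d·s + 1 ≤ dL`).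
[cite: Balaban1985RegularSpaces, (1.37) p.82, (1.42) p.83; Balaban1987RG1, (0.3) p.252] -/
theorem ineq137_crossing {s : ℕ} (hL : L = 2 * s + 1) (hd : 1 ≤ d) {α₁ : ℝ} (hα : 0 < α₁)
    (hsmall : (d : ℝ) * L * α₁ ≤ 1 / 8) (V₀ V' : Site d → Fin d → 𝔸ˣ) (hV₀ : ∀ x κ, V₀ x κ ∈ U1 𝔸)
    (hV' : ∀ x κ, V' x κ ∈ U1 𝔸) (q : Site d) (hs : BondSmall V' (q - halfVec L) (q + halfVec L) α₁)
    {w : 𝔸ˣ} (hw1 : w ∈ U1 𝔸) (hw : ‖(w : 𝔸) - 1‖ ≤ α₁) :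
    ‖BcrossZ L V₀ V' q w‖ < 2 * d * L * α₁ := by
  have hd' : (1 : ℝ) ≤ d := by exact_mod_cast hd
  have hLs : (L : ℝ) = 2 * s + 1 := by exact_mod_cast hL
  have hs0 : (0 : ℝ) ≤ s := Nat.cast_nonneg _
  set n : ℝ := d * (s : ℝ) with hndef
  have hn : 0 ≤ n := by rw [hndef]; positivity
  have hn1 : (n + 1) * α₁ ≤ (d : ℝ) * L * α₁ := by
    rw [hndef]
    have : (d : ℝ) * s + 1 ≤ d * L := by nlinarith
    nlinarith
  have hA := arith137 hn hα (hn1.trans hsmall)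
  have hτ : n * α₁ < 1 := by nlinarith
  have hS := norm_crossSumZ_le L hL V₀ V' hV₀ hV' q hα.le hs (by rw [← hndef]; exact hτ)
  rw [← hndef] at hS
  have hmid := norm_crossMidZ_sub_one_le L V₀ V' q hS (mem_U1.mp hw1).1 hw
  have hB := norm_BcrossZ_le_div L V₀ V' q hmid hA.1
  refine hB.trans_lt (hA.2.trans_le ?_)
  nlinarith

/-- Mirrored crossing bonds: `‖V′_b · R(g)exp[+iΣ] − 1‖ ≤ |V′_b − 1| + (e^σ − 1)` for `‖Σ‖ ≤ σ`, `‖V′_b‖ ≤ 1`, `g ∈ U1`. [cite: Balaban1985RegularSpaces, (1.37) p.82 (bookkeeping)] -/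
theorem norm_mirrorMidZ_sub_one_le (V₀ V' : Site d → Fin d → 𝔸ˣ) (q : Site d) {σ t : ℝ}
    (hS : ‖crossSumZ L V₀ V' q‖ ≤ σ) {g w : 𝔸ˣ} (hg : g ∈ U1 𝔸) (hw1 : ‖(w : 𝔸)‖ ≤ 1)
    (hw : ‖(w : 𝔸) - 1‖ ≤ t) :
    ‖(w : 𝔸) * ((g : 𝔸) * exp (I • crossSumZ L V₀ V' q) * ((g⁻¹ : 𝔸ˣ) : 𝔸)) - 1‖ ≤ t + (Real.exp σ - 1) := by
  have hE : ‖exp (I • crossSumZ L V₀ V' q) - 1‖ ≤ Real.exp σ - 1 :=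
    B7Transfer.norm_exp_sub_one_le_of_le _ (by rwa [norm_smul, Complex.norm_I, one_mul])
  have hC : ‖(g : 𝔸) * exp (I • crossSumZ L V₀ V' q) * ((g⁻¹ : 𝔸ˣ) : 𝔸) - 1‖ ≤ Real.exp σ - 1 :=
    (norm_units_conj_sub_one_le hg _).trans hE
  exact (B8Ineq170.norm_mul_sub_one_le_of_norm_le_one hw1).trans (add_le_add hw hC)

/-- **(1.37) on the mirrored crossing bonds, RECORD blocks**: the same hypotheses at the centred block `B(b₊)` and `g = Ū₀ʲ_b ∈ U1` give `|B_b| < 2dLα₁`.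
[cite: Balaban1985RegularSpaces, (1.37) p.82 (bookkeeping)] -/
theorem ineq137_crossing_mirrored {s : ℕ} (hL : L = 2 * s + 1) (hd : 1 ≤ d) {α₁ : ℝ} (hα : 0 < α₁)
    (hsmall : (d : ℝ) * L * α₁ ≤ 1 / 8) (V₀ V' : Site d → Fin d → 𝔸ˣ) (hV₀ : ∀ x κ, V₀ x κ ∈ U1 𝔸)
    (hV' : ∀ x κ, V' x κ ∈ U1 𝔸) (q : Site d) (hs : BondSmall V' (q - halfVec L) (q + halfVec L) α₁)
    {g w : 𝔸ˣ} (hg : g ∈ U1 𝔸) (hw1 : w ∈ U1 𝔸) (hw : ‖(w : 𝔸) - 1‖ ≤ α₁) :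
    ‖BcrossMirrorZ L V₀ V' q g w‖ < 2 * d * L * α₁ := by
  have hd' : (1 : ℝ) ≤ d := by exact_mod_cast hd
  have hLs : (L : ℝ) = 2 * s + 1 := by exact_mod_cast hL
  have hs0 : (0 : ℝ) ≤ s := Nat.cast_nonneg _
  set n : ℝ := d * (s : ℝ) with hndef
  have hn : 0 ≤ n := by rw [hndef]; positivity
  have hn1 : (n + 1) * α₁ ≤ (d : ℝ) * L * α₁ := by
    rw [hndef]
    have : (d : ℝ) * s + 1 ≤ d * L := by nlinarith
    nlinarith
  have hA := arith137 hn hα (hn1.trans hsmall)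
  have hτ : n * α₁ < 1 := by nlinarith
  have hS := norm_crossSumZ_le L hL V₀ V' hV₀ hV' q hα.le hs (by rw [← hndef]; exact hτ)
  rw [← hndef] at hS
  have hmid := norm_mirrorMidZ_sub_one_le L V₀ V' q hS hg (mem_U1.mp hw1).1 hw
  rw [add_comm] at hmid
  have h1 : ‖(w : 𝔸) * ((g : 𝔸) * exp (I • crossSumZ L V₀ V' q) * ((g⁻¹ : 𝔸ˣ) : 𝔸)) - 1‖ < 1 :=
    hmid.trans_lt hA.1
  have hB : ‖BcrossMirrorZ L V₀ V' q g w‖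
      ≤ (Real.exp (n * α₁ / (1 - n * α₁)) - 1 + α₁) / (1 - (Real.exp (n * α₁ / (1 - n * α₁)) - 1 + α₁)) := by
    rw [BcrossMirrorZ, norm_Iinv_smul]
    refine (norm_mlog_le_div h1).trans ?_
    exact div_le_div₀ ((norm_nonneg _).trans hmid) hmid (by linarith [hA.1]) (by linarith)
  refine hB.trans_lt (hA.2.trans_le ?_)
  nlinarith

/-- **Theorem 2's condition (1.37) from the assumption (1.35), RECORD blocks** — «B is given by formula (1.31) with V′ = Ũ′ʲ, |B| < 2dLα₁ by the assumption (1.35)»: with (1.35)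
`|U_c − (V₀)_c| ≤ α₁` on the bonds `c` of the CENTRED block `B(b₋) = [q − s𝟙, q + s𝟙]`, `|W − W₀| ≤ α₁` at the level-`j` bond, `V′ = pert U V₀`, `Ũ′ʲ_b = W·W₀⁻¹`, `0 < α₁`,
`dLα₁ ≤ 1∕8`: `|B_b| < 2dLα₁` for EITHER line of (1.31). [cite: Balaban1985RegularSpaces, (1.35) p.82, (1.37) p.82, Theorem 2 p.83; Balaban1987RG1, (0.3) p.252] -/
theorem ineq137_of_ineq135 {s : ℕ} (hL : L = 2 * s + 1) (hd : 1 ≤ d) {α₁ : ℝ} (hα : 0 < α₁)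
    (hsmall : (d : ℝ) * L * α₁ ≤ 1 / 8) (U V₀ : Site d → Fin d → 𝔸ˣ) (hU : ∀ x κ, U x κ ∈ U1 𝔸)
    (hV₀ : ∀ x κ, V₀ x κ ∈ U1 𝔸) (q : Site d)
    (h135 : ∀ (z : Site d) (μ : Fin d), q - halfVec L ≤ z → z + e μ ≤ q + halfVec L → ‖(U z μ : 𝔸) - (V₀ z μ : 𝔸)‖ ≤ α₁)
    {W W₀ : 𝔸ˣ} (hW : W ∈ U1 𝔸) (hW₀ : W₀ ∈ U1 𝔸) (h135b : ‖(W : 𝔸) - (W₀ : 𝔸)‖ ≤ α₁) :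
    ‖Bint (W * W₀⁻¹)‖ < 2 * d * L * α₁ ∧ ‖BcrossZ L V₀ (pert U V₀) q (W * W₀⁻¹)‖ < 2 * d * L * α₁ := by
  have hL1 : 1 ≤ L := by omega
  have hw1 : W * W₀⁻¹ ∈ U1 𝔸 := (U1 𝔸).mul_mem hW ((U1 𝔸).inv_mem hW₀)
  have hw : ‖((W * W₀⁻¹ : 𝔸ˣ) : 𝔸) - 1‖ ≤ α₁ := (norm_mul_inv_sub_one_le W hW₀).trans h135b
  have hs : BondSmall (pert U V₀) (q - halfVec L) (q + halfVec L) α₁ := fun z μ hz hzμ =>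
    (norm_pert_sub_one_le U V₀ z μ (hV₀ z μ)).trans (h135 z μ hz hzμ)
  exact ⟨ineq137_interior L hd hL1 hα hsmall hw,
    ineq137_crossing L hL hd hα hsmall V₀ (pert U V₀) hV₀ (pert_mem hU hV₀) q hs hw1 hw⟩

end SectB

end Literature.MathematicalPhysics.QuantumFieldTheory.Balaban1983to89.B8Thm2LogBRec

/-! ## Axiom audit (gate whitelist: `propext`, `Classical.choice`, `Quot.sound`) -/
#print axioms Literature.MathematicalPhysics.QuantumFieldTheory.Balaban1983to89.B8Thm2LogBRec.ineq137_of_ineq135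
#print axioms Literature.MathematicalPhysics.QuantumFieldTheory.Balaban1983to89.B8Thm2LogBRec.ineq137_crossing_mirrored
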